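import Literature.MeasureTheory.Group.InvariantQuotientCompactFibre          -- ★ `exists_isCompact_preimage_quotientMapOfLE_subset` (compact fibre ⇒ compact sets of `G ⧸ L` pull back to compact sets of `G ⧸ H`)
import Literature.MeasureTheory.Group.QuotientOrbitalIntegralProperContinuity -- ★ the (HYP) «uniformly proper modulo `M`» binder shape (`uniformlyProper_mono`, `…_comp`, …)
import HarnessLib

/-!
# Uniform properness of a Cartan family transfers DOWN a compact fibre: (HYP) modulo `M` + `M ⧸ T` compact ⇒ (HYP) modulo `T`
# (Deitmar–Echterhoff 2014 Lemma 9.3.3 ∕ Remark 1.5.2; Harish-Chandra–van Dijk 1970 Part I §3 Lemma 22)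

Topic `MeasureTheory/Group`; namespace `Literature.MeasureTheory.Group`.  THEOREMS ONLY (no `def`, no instance, no notation, no axiom, no named fact, no `sorry`); generic
topological groups.  Cell `pub/hodgecm-mathlib`, crux H413 (`stmt-HodgeConjecture-24833`), F0∕P3c line LH3 (closer stub `stub_N9`, N9″ DIRECT ROAD), letter L1
`HcOrbitalFamiliesStatement` pay-down **(I₂-InRegG-cpt-G′) «`orbFamGExt` is `C^∞` across a COMPACT wall»** (LH3-plan (g3) 2026-09-02T08:22:51Z (2)(iii) → F0P3b-p01 (g15)),
sub-brick (P-TRANSFER).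

WHY.  Near a semiregular point of a COMPACT wall the atlas `c ↦ gprimeTorus α S′ c` is uniformly proper modulo the CENTRALISER `M′ = Z(s)` (★ D4b-1(α)
`uniformlyProper_gprimeTorus_of_semireg`, whose hypothesis at the wall place allows the wall), not modulo the torus `T′ = chartTorusG S′` — but the chart orbital functional
★ `chartOrbG` integrates over `G′_∞ ⧸ T′` and its `C^∞`-engine ★ `contDiffOn_chartOrbG_of_uniformlyProper` wants (HYP) modulo `T′`.  At a COMPACT wall the fibre `M′ ⧸ T′`
(a `U(2)`-type block modulo its torus) is COMPACT, and uniform properness passes from `M′` down to `T′` — this file, in the (HYP) binder shape of ★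
`QuotientOrbitalIntegralProperContinuity` verbatim.

* §1 **`uniformlyProper_of_le_of_compactSpace_quotient (T M : Subgroup G) (hTM : T ≤ M) [CompactSpace (↥M ⧸ T.subgroupOf M)] (c : X → G) (S) (h : (HYP) mod M on S) :
  (HYP) mod T on S`** — `G` locally compact (★ `exists_isCompact_preimage_quotientMapOfLE_subset`: `π : G ⧸ T → G ⧸ M` pulls compact sets back to compact sets).
HONEST LABEL: HC_CM is proved only modulo the 7 printed citations (2 remaining named inputs: hLiu418 = `stmt-HodgeConjecture-24832`, h413 = `stmt-HodgeConjecture-24833`) until rung 0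
closes; count-neutral topology, pays nothing by itself.

## References
* [DeitmarEchterhoff2014] A. Deitmar, S. Echterhoff, *Principles of Harmonic Analysis*, 2nd ed. (2014), Remark 1.5.2 (compact sets lift along open quotient maps), Lemma 9.3.3.
* [HarishChandra1970] Harish-Chandra (notes by G. van Dijk), *Harmonic Analysis on Reductive p-adic Groups*, LNM 162 (1970), Part I §3 Lemma 22 (the compactness lemma).
* [Rogawski1990] J. D. Rogawski, *Automorphic Representations of Unitary Groups in Three Variables*, Ann. of Math. Stud. 123 (1990), §4.12 Lemma 4.12.1 p. 66.
-/

set_option autoImplicit false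

open _root_.Topology Set Filter
open scoped Pointwise

namespace Literature.MeasureTheory.Group

section Transfer

variable {G : Type*} [Group G] [TopologicalSpace G] [IsTopologicalGroup G] [LocallyCompactSpace G] {X : Type*} [TopologicalSpace X]

/-- **(HYP) TRANSFERS DOWN A COMPACT FIBRE**: if the family `c : X → G` is uniformly proper on `S` modulo a closed-or-not subgroup `M` (for every compact `K ⊆ S` and compact
`C ⊆ G` the classes `y M` with `y·c(x)·y⁻¹ ∈ C`, `x ∈ K`, lie in a compact of `G ⧸ M`) and `T ≤ M` has COMPACT quotient `M ⧸ T`, then `c` is uniformly proper on `S`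
modulo `T` (the classes `y T` lie in the preimage of that compact under `G ⧸ T → G ⧸ M`, compact by ★ `exists_isCompact_preimage_quotientMapOfLE_subset`).
[cite: DeitmarEchterhoff2014, Remark 1.5.2; Lemma 9.3.3] [cite: HarishChandra1970, Part I §3 Lemma 22] -/
theorem uniformlyProper_of_le_of_compactSpace_quotient (T M : Subgroup G) (hTM : T ≤ M) [CompactSpace (↥M ⧸ T.subgroupOf M)]
    (c : X → G) (S : Set X)
    (h : ∀ K ⊆ S, IsCompact K → ∀ C : Set G, IsCompact C →
      ∃ 𝒦 : Set (G ⧸ M), IsCompact 𝒦 ∧ ∀ x ∈ K, ∀ y : G, y * c x * y⁻¹ ∈ C → (QuotientGroup.mk y : G ⧸ M) ∈ 𝒦) :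
    ∀ K ⊆ S, IsCompact K → ∀ C : Set G, IsCompact C →
      ∃ 𝒦 : Set (G ⧸ T), IsCompact 𝒦 ∧ ∀ x ∈ K, ∀ y : G, y * c x * y⁻¹ ∈ C → (QuotientGroup.mk y : G ⧸ T) ∈ 𝒦 := by
  intro K hKS hK C hC
  obtain ⟨𝒦, h𝒦, hmem⟩ := h K hKS hK C hC
  obtain ⟨𝒦', h𝒦', hsub⟩ := exists_isCompact_preimage_quotientMapOfLE_subset T M hTM h𝒦
  refine ⟨𝒦', h𝒦', fun x hx y hy => hsub ?_⟩
  show Subgroup.quotientMapOfLE hTM (QuotientGroup.mk y) ∈ 𝒦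
  rw [Subgroup.quotientMapOfLE_apply_mk]
  exact hmem x hx y hy

end Transfer

end Literature.MeasureTheory.Group
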